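import Summits.HodgeConjecture.CorCM.Census.DihedralSexticPair
import Summits.HodgeConjecture.CorCM.CMThreefoldPairWeilClassesOfMarkman
import Summits.HodgeConjecture.CorCM.CMBalancedWeightSplitting
import HarnessLib

/-!
# COR-CM — frame transfer for the pair `B₀ × B₁` of a non-Galois sextic CM field `K = k·F₀`: Galois-balanced weights
# are model-balanced; eigenvalues and fibre counts of the `k`-structure `ι₀(iδ) ⊕ ι₁(īδ)`

Cell `pub-hodgecm2` (COR-CM), seat b30 gen 14 (2026-08-21); COUNT-NEUTRAL; theorems only, no definition, no named fact,
no `sorry`.  The bridge between the finite model `Census/DihedralSexticPair.lean` (12 points, `S₃ × C₂`, kernel census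
`balanced_classification`) and the real carriers, consumed by `CorCM/DihedralSexticPairHodgeOfMarkman.lean` (the Hodge
conjecture for `B₀ × B₁` modulo Markman).

SETTING.  `k` an imaginary quadratic field (`[k:ℚ] = 2`, CM), `K` a sextic field, `i : k → K`, `δ ∈ 𝓞_k` with
`τ(δ) = i√d` for a fixed `τ : k → ℂ`, `d ≥ 1`.  A FRAME of `K` over `(k, i, τ)` is a bijection
`e : Hom(K, ℂ) ≃ ℤ/3 × Bool` ("real place", "sign") such that complex conjugation keeps the place and flips the sign
(`he_conj`), the sign of `s` is `true` iff `s ∘ i = τ` (`he_sign`), and the six sign-preserving permutations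
`(p, b) ↦ (±p + j, b)` are realised by automorphisms of `ℂ` (`he_gal`) — i.e. «`Gal(K^{gal}/ℚ) = S₃ × C₂` acts on
`Hom(K, ℚ̄) = Hom(F₀, ℝ) × Hom(k, ℂ)` factorwise», `K = k·F₀` with `F₀` a NON-cyclic totally real cubic.  The two CM
types are read in the frame: `Φ_j` has sign `true` exactly over the place `j` (`hΦ`, `j = 0, 1`).

* §1 `balanced_image_of_isGaloisBalancedAlg` — an `Aut(ℂ)`-balanced weight `S ⊆ Hom(K,ℂ) ⊔ Hom(K,ℂ)` of
  `⨁_{j<2} A_j` (Pohlmann's condition for the CM algebra `K × K`, the tree's `IsGaloisBalancedAlg`) maps under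
  `(j, s) ↦ (j, e s)` to a balanced weight of the model (all twelve elements of `S₃ × C₂` are realised by automorphisms of
  `ℂ`: `exists_ringEquiv_realises`); reading back the three outcomes of the census: `conj_smul_mem_of_conjStable_image`,
  `mem_iff_of_image_eq_weilPlus`, `mem_iff_of_image_eq_weilMinus` [cite: GaoUllmo2025, Thm 3.1 (3.2)]
  [cite: Gordon1999HodgeAVSurvey, §9.2];
* §2 `apply_weilFamily_eq` — on the points of `W₊ = {(0,s) : sign s} ⊔ {(1,s) : ¬ sign s}` the family
  `a = (iδ, īδ)`, `ī = i ∘ c_k`, has the constant eigenvalue `+i√d`, on `W₋` the value `-i√d`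
  (`Hom(k,ℂ) = {τ, τ̄}`, `eq_or_eq_conjugate`); `card_fibre_zero` / `card_fibre_one` — the fibre counts of `Φ₀` over
  `τ` via `i` and of `Φ₁` over `τ` via `ī` are `1` and `2` (the hypotheses of the seat's
  `CMThreefoldPair.weilClassesOf_prod_le_algebraicClasses_of_markman_curveFree`) [cite: Deligne1982HodgeCycles, §5 (c)]
  [cite: Shimura1998, §5.2] [cite: vanGeemen1994HodgeAV, 4.9].

## References
* [GaoUllmo2025] Z. Gao, E. Ullmo, J. Inst. Math. Jussieu 25 (2025), Thm 3.1.  [Pohlmann1968] H. Pohlmann, Ann. of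
  Math. 88 (1968), Thm 1.  [Gordon1999HodgeAVSurvey] B. B. Gordon, CRM Monogr. 10 (1999), §9.2.
* [Deligne1982HodgeCycles] P. Deligne (notes by J. S. Milne), LNM 900 (1982), §5 (c).
* [Shimura1998] G. Shimura, *Abelian Varieties with Complex Multiplication and Modular Functions* (1998), §5.2, §18.2.
* [vanGeemen1994HodgeAV] B. van Geemen, LNM 1594 (1994), 4.9.
-/

noncomputable section

open CategoryTheory CategoryTheory.Limits NumberField

namespace Summit.HodgeConjecture.CorCM.DihedralSexticPair

open Literature.AlgebraicGeometry Literature.AlgebraicGeometry.Motives Literature.AlgebraicGeometry.HodgeTheory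
open Literature.AlgebraicGeometry.ComplexMultiplication (IsCMTypeRealisation)
open Literature.AlgebraicGeometry.Pohlmann1968
open Literature.AlgebraicTopology.SingularHomology
open Literature.NumberTheory.ComplexMultiplication
open Summit.HodgeConjecture.CorCM.CMWeights (conj_smul_sigma_eq smul_sigma_eq)
open Summit.HodgeConjecture.CorCM.Census.DihedralSexticPair (Pt act phi weilPlus weilMinus balanced conjStable
  act_apply mem_phi_iff weil_structure)

open scoped Classical Pointwise

/-! ## §1 Frame transfer: balanced weights of `⨁_{j<2} A_j` are model-balanced -/

section Frame

variable {K : Type} [Field K] (e : (K →+* ℂ) ≃ ZMod 3 × Bool)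

/-- The model map `(j, s) ↦ (j, e s)` is injective. [folklore] -/
theorem toPt_injective : Function.Injective fun x : (_ : Fin 2) × (K →+* ℂ) => ((x.1, e x.2) : Pt) := by
  rintro ⟨j, s⟩ ⟨j', s'⟩ h
  simp only [Prod.mk.injEq] at h
  obtain ⟨rfl, h2⟩ := h
  rw [e.injective h2]

/-- Counting through the model map: `#{x ∈ S | P x} = #{y ∈ e(S) | Q y}` when `P = Q ∘ e`. [folklore] -/
theorem ncard_sep_eq_card_filter_image (S : Finset ((_ : Fin 2) × (K →+* ℂ))) (P : ((_ : Fin 2) × (K →+* ℂ)) → Prop)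
    (Q : Pt → Prop) [DecidablePred Q] (hPQ : ∀ x, P x ↔ Q (x.1, e x.2)) :
    {x | x ∈ S ∧ P x}.ncard = ((S.image fun x => ((x.1, e x.2) : Pt)).filter Q).card := by
  rw [show {x | x ∈ S ∧ P x} = ↑(S.filter P) by ext x; simp, Set.ncard_coe_finset, Finset.filter_image,
    Finset.card_image_of_injective _ (toPt_injective e)]
  exact congrArg Finset.card (Finset.filter_congr fun x _ => hPQ x)

/-- In a frame, the model action `act j f d` on `(m, e s)` is computed coordinatewise. [folklore] -/
theorem act_mk_apply (j : ZMod 3) (f d : Bool) (m : Fin 2) (s : K →+* ℂ) :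
    act j f d (m, e s) = (m, (if f then -(e s).1 else (e s).1) + j, if d then (e s).2 else !(e s).2) := by
  conv_lhs => rw [← Prod.mk.eta (p := e s)]
  rfl

variable {e} {Φ : Fin 2 → CMType K}
  (hΦ : ∀ (j : Fin 2) (s : K →+* ℂ), s ∈ (Φ j).1 ↔ (e s).2 = decide ((e s).1.val = j.val))

include hΦ in
/-- **Membership read in the frame**: if `τ ∈ Aut(ℂ)` realises the model element `(j, f, d)` through `e`, then
`τ ∘ s ∈ Φ_m ↔ act j f d (m, e s) ∈ Φ_Y`. [cite: GaoUllmo2025, Thm 3.1 (3.2)] -/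
theorem comp_mem_iff_act_mem_phi {τ : ℂ ≃+* ℂ} {j : ZMod 3} {f d : Bool}
    (hτ : ∀ s : K →+* ℂ, e ((τ : ℂ →+* ℂ).comp s) =
      ((if f then -(e s).1 else (e s).1) + j, if d then (e s).2 else !(e s).2))
    (x : (_ : Fin 2) × (K →+* ℂ)) :
    (τ : ℂ →+* ℂ).comp x.2 ∈ (Φ x.1).1 ↔ act j f d (x.1, e x.2) ∈ phi := by
  rw [hΦ, hτ, act_mk_apply, mem_phi_iff]

variable (he_conj : ∀ s : K →+* ℂ, e (ComplexEmbedding.conjugate s) = ((e s).1, !(e s).2))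
  (he_gal : ∀ (j : ZMod 3) (f : Bool), ∃ σ : ℂ ≃+* ℂ, ∀ s : K →+* ℂ,
    e ((σ : ℂ →+* ℂ).comp s) = ((if f then -(e s).1 else (e s).1) + j, (e s).2))

include he_conj he_gal in
/-- **Every element of `S₃ × C₂` is realised by an automorphism of `ℂ`** in a frame: the sign-preserving ones by
`he_gal`, the others by composing with complex conjugation. [cite: Gordon1999HodgeAVSurvey, §9.2 (proof)] -/
theorem exists_ringEquiv_realises (j : ZMod 3) (f d : Bool) : ∃ τ : ℂ ≃+* ℂ, ∀ s : K →+* ℂ,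
    e ((τ : ℂ →+* ℂ).comp s) = ((if f then -(e s).1 else (e s).1) + j, if d then (e s).2 else !(e s).2) := by
  obtain ⟨σ, hσ⟩ := he_gal j f
  cases d with
  | true => exact ⟨σ, fun s => by rw [hσ]; rfl⟩
  | false =>
    refine ⟨(starRingAut : ℂ ≃+* ℂ).trans σ, fun s => ?_⟩
    have hc : (((starRingAut : ℂ ≃+* ℂ).trans σ : ℂ ≃+* ℂ) : ℂ →+* ℂ).comp s =
        (σ : ℂ →+* ℂ).comp (ComplexEmbedding.conjugate s) := RingHom.ext fun _ => rfl
    rw [hc, hσ, he_conj]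
    rfl

include hΦ he_conj he_gal in
/-- **FRAME TRANSFER**: an `Aut(ℂ)`-balanced weight of `⨁_{j<2} A_j` (`IsGaloisBalancedAlg`, Pohlmann's condition
(3.2) for the CM algebra `K × K`) maps to a balanced weight of the 12-point model. [cite: GaoUllmo2025, Thm 3.1 (3.2)] -/
theorem balanced_image_of_isGaloisBalancedAlg {S : Finset ((_ : Fin 2) × (K →+* ℂ))}
    (hS : IsGaloisBalancedAlg (K := fun _ => K) Φ S) :
    balanced (S.image fun x => ((x.1, e x.2) : Pt)) = true := by
  rw [balanced, decide_eq_true_eq]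
  intro g
  obtain ⟨τ, hτ⟩ := exists_ringEquiv_realises he_conj he_gal g.1 g.2.1 g.2.2
  rw [← ncard_sep_eq_card_filter_image e S (fun x => (τ : ℂ →+* ℂ).comp x.2 ∈ (Φ x.1).1)
      (fun y => act g.1 g.2.1 g.2.2 y ∈ phi) (comp_mem_iff_act_mem_phi hΦ hτ),
    ← ncard_sep_eq_card_filter_image e S (fun x => (τ : ℂ →+* ℂ).comp x.2 ∉ (Φ x.1).1)
      (fun y => act g.1 g.2.1 g.2.2 y ∉ phi) (fun x => (comp_mem_iff_act_mem_phi hΦ hτ x).not)]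
  exact hS τ

include he_conj in
/-- Reading back conjugation-stability from the model. [folklore] -/
theorem conj_smul_mem_of_conjStable_image {S : Finset ((_ : Fin 2) × (K →+* ℂ))}
    (h : conjStable (S.image fun x => ((x.1, e x.2) : Pt)) = true) :
    ∀ x ∈ S, (starRingAut : ℂ ≃+* ℂ) • x ∈ S := by
  rw [conjStable, decide_eq_true_eq] at h
  intro x hx
  have h1 := h (x.1, e x.2) (Finset.mem_image_of_mem _ hx)
  rw [act_mk_apply] at h1
  simp only [Bool.false_eq_true, ↓reduceIte, add_zero] at h1
  have h2 : ((((starRingAut : ℂ ≃+* ℂ) • x).1, e ((starRingAut : ℂ ≃+* ℂ) • x).2) : Pt) =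
      (x.1, (e x.2).1, !(e x.2).2) := by
    rw [conj_smul_sigma_eq, he_conj]
  rw [← h2] at h1
  exact ((toPt_injective e).mem_finset_image).1 h1

/-- Reading back the Weil weight `W₊`: `S = {(j, s) | sign(s) = [j = 0]}`, of size `6`. [cite: Deligne1982HodgeCycles, §5 (c)] -/
theorem mem_iff_of_image_eq_weilPlus {S : Finset ((_ : Fin 2) × (K →+* ℂ))}
    (h : (S.image fun x => ((x.1, e x.2) : Pt)) = weilPlus) :
    (∀ x : (_ : Fin 2) × (K →+* ℂ), x ∈ S ↔ (e x.2).2 = decide (x.1 = 0)) ∧ S.card = 6 := by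
  refine ⟨fun x => ?_, ?_⟩
  · rw [← (toPt_injective e).mem_finset_image (s := S), h, weil_structure.1]
  · rw [← Finset.card_image_of_injective S (toPt_injective e), h, weil_structure.2.2.2.1]

/-- Reading back the Weil weight `W₋`: `S = {(j, s) | sign(s) = [j ≠ 0]}`, of size `6`. [cite: Deligne1982HodgeCycles, §5 (c)] -/
theorem mem_iff_of_image_eq_weilMinus {S : Finset ((_ : Fin 2) × (K →+* ℂ))}
    (h : (S.image fun x => ((x.1, e x.2) : Pt)) = weilMinus) :
    (∀ x : (_ : Fin 2) × (K →+* ℂ), x ∈ S ↔ (e x.2).2 = !decide (x.1 = 0)) ∧ S.card = 6 := by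
  refine ⟨fun x => ?_, ?_⟩
  · rw [← (toPt_injective e).mem_finset_image (s := S), h, weil_structure.2.1]
  · rw [← Finset.card_image_of_injective S (toPt_injective e), h, weil_structure.2.2.2.2.1]

end Frame

/-! ## §2 The `k`-structure `φ = ι₀(iδ) ⊕ ι₁(īδ)`: eigenvalues and fibre counts in the frame -/

section Quadratic

variable {k : Type} [Field k] [NumberField k] [IsCMField k] {K : Type} [Field K] [NumberField K]

omit [IsCMField k] in
/-- `Hom(k, ℂ) = {τ, τ̄}` for a quadratic field: every `σ : k → ℂ` is `τ` or `τ̄` (`τ(δ) = i√d`, `d ≥ 1`, so `τ̄ ≠ τ`).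
[folklore] -/
theorem eq_or_eq_conjugate (h2 : Module.finrank ℚ k = 2) {δ : 𝓞 k} {d : ℕ} (hd : 0 < d) {τ : k →+* ℂ}
    (hτ : τ (δ : k) = Complex.I * (Real.sqrt d : ℂ)) (σ : k →+* ℂ) :
    σ = τ ∨ σ = ComplexEmbedding.conjugate τ := by
  have hne := CMThreefoldPair.conjugate_ne_of_apply_eq hd hτ
  have huniv : ({τ, ComplexEmbedding.conjugate τ} : Finset (k →+* ℂ)) = Finset.univ := by
    apply Finset.eq_univ_of_card
    rw [Finset.card_pair hne.symm, Embeddings.card, h2]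
  have hσ := Finset.mem_univ σ
  rw [← huniv, Finset.mem_insert, Finset.mem_singleton] at hσ
  exact hσ

omit [NumberField K] in
/-- `s ∘ (i ∘ c_k) = (s ∘ i)‾` for the complex conjugation `c_k` of the CM field `k` (Mathlib
`IsCMField.complexEmbedding_complexConj`). [folklore] -/
theorem comp_comp_complexConj (i : k →+* K) (s : K →+* ℂ) :
    s.comp (i.comp (IsCMField.complexConj k).toRingEquiv.toRingHom) = ComplexEmbedding.conjugate (s.comp i) := by
  refine RingHom.ext fun z => ?_
  change s (i (IsCMField.complexConj k z)) = starRingEnd ℂ (s (i z))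
  exact IsCMField.complexEmbedding_complexConj k (s.comp i) z

variable {e : (K →+* ℂ) ≃ ZMod 3 × Bool} {i : k →+* K} {τ : k →+* ℂ}
  (he_sign : ∀ s : K →+* ℂ, s.comp i = τ ↔ (e s).2 = true)

omit [IsCMField k] [NumberField K] in
include he_sign in
/-- In the frame, sign `false` means `s ∘ i = τ̄`. [folklore] -/
theorem comp_eq_conjugate_of_sign_false (h2 : Module.finrank ℚ k = 2) {δ : 𝓞 k} {d : ℕ} (hd : 0 < d)
    (hτ : τ (δ : k) = Complex.I * (Real.sqrt d : ℂ)) {s : K →+* ℂ} (hs : (e s).2 = false) :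
    s.comp i = ComplexEmbedding.conjugate τ := by
  rcases eq_or_eq_conjugate h2 hd hτ (s.comp i) with h | h
  · rw [he_sign s] at h
    rw [h] at hs
    exact absurd hs (by decide)
  · exact h

omit [NumberField K] in
include he_sign in
/-- **Eigenvalues of `φ = ι₀(iδ) ⊕ ι₁(īδ)` on the eigenlines**: `s(iδ) = i√d` iff sign `true`, `s(īδ) = i√d` iff sign
`false`; precisely, on the points of `W₊ = {(0,s) : sign s} ⊔ {(1,s) : ¬ sign s}` the value is `+i√d`, on those of `W₋`
it is `-i√d`. [cite: vanGeemen1994HodgeAV, 4.9] [cite: Shimura1998, §5.2] -/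
theorem apply_weilFamily_eq (h2 : Module.finrank ℚ k = 2) {δ : 𝓞 k} {d : ℕ} (hd : 0 < d)
    (hτ : τ (δ : k) = Complex.I * (Real.sqrt d : ℂ)) (x : (_ : Fin 2) × (K →+* ℂ)) :
    ((e x.2).2 = decide (x.1 = 0) →
      x.2 ((![RingOfIntegers.mapRingHom i δ,
        RingOfIntegers.mapRingHom (i.comp (IsCMField.complexConj k).toRingEquiv.toRingHom) δ] x.1 : 𝓞 K) : K) =
        Complex.I * (Real.sqrt d : ℂ)) ∧
    ((e x.2).2 = !decide (x.1 = 0) →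
      x.2 ((![RingOfIntegers.mapRingHom i δ,
        RingOfIntegers.mapRingHom (i.comp (IsCMField.complexConj k).toRingEquiv.toRingHom) δ] x.1 : 𝓞 K) : K) =
        -(Complex.I * (Real.sqrt d : ℂ))) := by
  obtain ⟨j, s⟩ := x
  have hconj : ComplexEmbedding.conjugate τ (δ : k) = -(Complex.I * (Real.sqrt d : ℂ)) := by
    rw [ComplexEmbedding.conjugate_coe_eq, hτ, map_mul, Complex.conj_I, Complex.conj_ofReal, neg_mul]
  have hval0 : s ((RingOfIntegers.mapRingHom i δ : 𝓞 K) : K) = (s.comp i) (δ : k) := by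
    rw [RingOfIntegers.mapRingHom_apply]; rfl
  have hval1 : s ((RingOfIntegers.mapRingHom (i.comp (IsCMField.complexConj k).toRingEquiv.toRingHom) δ : 𝓞 K) : K)
      = (ComplexEmbedding.conjugate (s.comp i)) (δ : k) := by
    rw [RingOfIntegers.mapRingHom_apply, ← comp_comp_complexConj i s]; rfl
  fin_cases j
  · simp only [Fin.zero_eta, Fin.isValue, decide_true, Matrix.cons_val_zero, Bool.not_true]
    refine ⟨fun hs => ?_, fun hs => ?_⟩
    · rw [hval0, (he_sign s).2 hs, hτ]
    · rw [hval0, comp_eq_conjugate_of_sign_false he_sign h2 hd hτ hs, hconj]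
  · simp only [Fin.mk_one, Fin.isValue, one_ne_zero, decide_false, Matrix.cons_val_one, Matrix.cons_val_zero,
      Bool.not_false]
    refine ⟨fun hs => ?_, fun hs => ?_⟩
    · rw [hval1, comp_eq_conjugate_of_sign_false he_sign h2 hd hτ hs, ComplexEmbedding.conjugate_coe_eq, hconj,
        map_neg, map_mul, Complex.conj_I, Complex.conj_ofReal, neg_mul, neg_neg]
    · rw [hval1, (he_sign s).2 hs, hconj]

/-- A bijection transports counts: `#{a | e a ∈ T} = #T`. [folklore] -/
theorem card_filter_equiv_mem {α β : Type*} [Fintype α] [DecidableEq β] (e : α ≃ β) (T : Finset β) :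
    (Finset.univ.filter fun a => e a ∈ T).card = T.card := by
  rw [← Finset.card_map (s := T) e.symm.toEmbedding]
  congr 1
  ext a
  rw [Finset.mem_filter, Finset.mem_map_equiv, Equiv.symm_symm]
  simp

variable {Φ : Fin 2 → CMType K}
  (hΦ : ∀ (j : Fin 2) (s : K →+* ℂ), s ∈ (Φ j).1 ↔ (e s).2 = decide ((e s).1.val = j.val))

omit [NumberField k] [IsCMField k] in
include he_sign hΦ in
/-- **Fibre count `1`**: exactly one embedding of `Φ₀` restricts to `τ` along `i` (`(A₀, k)` has type `(1,2)`).
[cite: Deligne1982HodgeCycles, §5 (c)] -/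
theorem card_fibre_zero : (Finset.univ.filter fun s : K →+* ℂ => s.comp i = τ ∧ s ∈ (Φ 0).1).card = 1 := by
  have hfilter : (Finset.univ.filter fun s : K →+* ℂ => s.comp i = τ ∧ s ∈ (Φ 0).1) =
      Finset.univ.filter fun s => e s ∈ ({((0 : ZMod 3), true)} : Finset (ZMod 3 × Bool)) := by
    refine Finset.filter_congr fun s _ => ?_
    rw [he_sign, hΦ 0 s, Finset.mem_singleton, Prod.ext_iff]
    constructor
    · rintro ⟨h1, h2⟩
      rw [h1] at h2
      refine ⟨?_, h1⟩
      have h3 : (e s).1.val = (0 : Fin 2).val := of_decide_eq_true h2.symm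
      exact Fin.ext h3
    · rintro ⟨h1, h2⟩
      refine ⟨h2, ?_⟩
      rw [h2, h1]
      rfl
  rw [hfilter, card_filter_equiv_mem, Finset.card_singleton]

include he_sign hΦ in
/-- **Fibre count `2`**: exactly two embeddings of `Φ₁` restrict to `τ` along `ī = i ∘ c_k` (`(A₁, k)` has type `(2,1)`
for the conjugate `k`-structure). [cite: Deligne1982HodgeCycles, §5 (c)] -/
theorem card_fibre_one (h2 : Module.finrank ℚ k = 2) {δ : 𝓞 k} {d : ℕ} (hd : 0 < d)
    (hτ : τ (δ : k) = Complex.I * (Real.sqrt d : ℂ)) :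
    (Finset.univ.filter fun s : K →+* ℂ =>
      s.comp (i.comp (IsCMField.complexConj k).toRingEquiv.toRingHom) = τ ∧ s ∈ (Φ 1).1).card = 2 := by
  have hfilter : (Finset.univ.filter fun s : K →+* ℂ =>
      s.comp (i.comp (IsCMField.complexConj k).toRingEquiv.toRingHom) = τ ∧ s ∈ (Φ 1).1) =
      Finset.univ.filter fun s => e s ∈ ({((0 : ZMod 3), false), ((2 : ZMod 3), false)} : Finset (ZMod 3 × Bool)) := by
    refine Finset.filter_congr fun s _ => ?_
    have hsign : s.comp (i.comp (IsCMField.complexConj k).toRingEquiv.toRingHom) = τ ↔ (e s).2 = false := by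
      rw [comp_comp_complexConj]
      constructor
      · intro h1
        by_contra h3
        rw [Bool.not_eq_false, ← he_sign] at h3
        rw [h3] at h1
        exact CMThreefoldPair.conjugate_ne_of_apply_eq hd hτ h1
      · intro h1
        rw [comp_eq_conjugate_of_sign_false he_sign h2 hd hτ h1]
        exact ComplexEmbedding.involutive_conjugate k τ
    rw [hsign, hΦ 1 s]
    have key : ∀ y : ZMod 3 × Bool, (y.2 = false ∧ (y.2 = decide (y.1.val = (1 : Fin 2).val))) ↔
        y ∈ ({((0 : ZMod 3), false), ((2 : ZMod 3), false)} : Finset (ZMod 3 × Bool)) := by decide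
    exact key (e s)
  rw [hfilter, card_filter_equiv_mem]
  decide

end Quadratic

end Summit.HodgeConjecture.CorCM.DihedralSexticPair

end
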